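import Literature.NumberTheory.GaloisRepresentations.GrossencharakterAlgebra
import Literature.NumberTheory.GaloisRepresentations.TeichmullerLiftMonomial
import Literature.NumberTheory.GaloisRepresentations.HeckeCharacterOfRayClass
import HarnessLib

/-!
# The Teichmüller twist — preliminaries (`e`-adic residues, odd inverses)

Route `ResidualThetaTransportAtTwo`, crux K0⁺ `HeckeThetaPartnerAdicAtTwo` (stmt-BirchSwinnertonDyer-20690),
helper §E2 of the line "proof from print", preliminaries for `…TeichmullerTwist.lean`.  THEOREMS ONLY
(no definition, no named fact, no `sorry`).

Setting: a number field `k`, a rational prime `p` INERT in `k` (`(p)` prime in `𝓞 k`), a ring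
isomorphism `e : ℚ̄_p ≃ ℂ` (the tree's `PadicAlgCl.nonempty_ringEquiv_complex`) through which complex
algebraic numbers are read `p`-adically, an ideal `𝔪 ≠ 0` of `𝓞 k` prime to `p`, a Größencharakter
`ψ₀ mod 𝔪` of some infinity type `(pτ, qτ)` (ideal-theoretic, `IsGrossencharakter`), and ANY function
`χ` on the primes such that `χ`, `ψ₀` are `e`-adic units at the primes `v ∤ p𝔪` and the MATCHING
CONDITION holds: `χ̃((b)) ≡ ψ̃₀((b))` (`e`-adically) for every `b ≢ 0 mod p` with `b ≡ 1 mod 𝔪`.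

**Main result** `exists_isGrossencharakter_congr`: there is a Größencharakter `ψ mod 𝔪` of the same
type `(pτ, qτ)` with `ψ(v) ≡ χ(v)` at every `v ∤ p𝔪` and `ψ̃((b)) = ψ̃₀((b)) · u_b`, `u_b` a root of unity of
order prime to `p` congruent to `χ̃((b))/ψ̃₀((b))`, for every `b` prime to `p𝔪`.  Construction
(classical: "twist by the Teichmüller lift of the reduction of `χ/ψ₀`"): `θ = χ/ψ₀` is an `e`-adic unit
off `p𝔪`, its reductions have bounded order prime to `p` (class number × `#(𝓞 k/𝔪)ˣ`, through the
matching condition), so the Teichmüller section (tree: `exists_teichmullerSection`) turns them into a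
multiplicative root-of-unity valued `η` on the ideals prime to `p𝔪`; the matching condition makes `η` a
ray class character `mod 𝔪` on those ideals, and the single prime `(p)` is filled in through an odd
`c₀ ≡ p mod 𝔪`.  Then `ψ = ψ₀ η`.

References: [NeukirchANT1999] VII §6; [SerreLocalFields1979] II §4 Prop. 8 (Teichmüller
representatives); [Washington1997] §5.1.
-/

set_option autoImplicit false
set_option linter.dupNamespace false

noncomputable section

open scoped NumberField ComplexConjugate
open NumberField IsDedekindDomain IsLocalRing
open Literature.NumberTheory.GaloisRepresentations Literature.NumberTheory.LFunctions

namespace Summit.BirchSwinnertonDyer.BirchSwinnertonDyer.Theorems.HeckeThetaPartner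

variable {k : Type} [Field k] [NumberField k] {p : ℕ} [Fact p.Prime]

/-! ### `e`-adic sizes of values of characters -/

/-- A complex root of unity is an `e`-adic unit. [folklore] -/
theorem norm_symm_eq_one_of_pow_eq_one (e : PadicAlgCl p ≃+* ℂ) {x : ℂ} {n : ℕ} (hn : 0 < n)
    (h : x ^ n = 1) : ‖e.symm x‖ = 1 := by
  have h1 : ‖e.symm x‖ ^ n = 1 := by rw [← norm_pow, ← map_pow, h, map_one, norm_one]
  exact (pow_eq_one_iff_of_nonneg (norm_nonneg _) hn.ne').mp h1

/-- If every prime dividing `I ≠ 0` has an `e`-adically unit value then so does `χ̃(I)`. [folklore] -/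
theorem norm_symm_idealPow_eq_one (e : PadicAlgCl p ≃+* ℂ) (ψ : HeightOneSpectrum (𝓞 k) → ℂ)
    {I : Ideal (𝓞 k)} (hI : I ≠ ⊥)
    (h : ∀ v : HeightOneSpectrum (𝓞 k), I ≤ v.asIdeal → ‖e.symm (ψ v)‖ = 1) :
    ‖e.symm (idealPow k ψ I)‖ = 1 := by
  classical
  unfold idealPow
  rw [finprod_eq_prod _ (mulSupport_idealPow_finite ψ hI), map_prod, norm_prod]
  refine Finset.prod_eq_one fun v _ => ?_
  by_cases hc : (Associates.mk v.asIdeal).count (Associates.mk I).factors = 0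
  · rw [hc, pow_zero, map_one, norm_one]
  · rw [map_pow, norm_pow, h v (Ideal.le_of_dvd ((Associates.count_ne_zero_iff_dvd hI v.irreducible).mp hc)),
      one_pow]

/-! ### The `e`-adic residue map on complex numbers of size `≤ 1` -/

/-- **Reduction of complex numbers along `e : ℚ̄_p ≃ ℂ`.** There is a map `ρ : ℂ → k̄_p` which on the
complex numbers `x` with `‖e⁻¹ x‖ ≤ 1` is the residue of `e⁻¹ x ∈ ℤ̄_p`: multiplicative, `ρ 1 = 1`,
`ρ x = ρ y ↔ ‖e⁻¹ x - e⁻¹ y‖ < 1`, non-zero on `e`-adic units, and `ρ (e w) = w̄` for `w ∈ ℤ̄_p`.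
[folklore] -/
theorem exists_residueMap (e : PadicAlgCl p ≃+* ℂ) :
    ∃ ρ : ℂ → padicAlgClResidueField p,
      (∀ x y : ℂ, ‖e.symm x‖ ≤ 1 → ‖e.symm y‖ ≤ 1 → ρ (x * y) = ρ x * ρ y) ∧ ρ 1 = 1 ∧
      (∀ x : ℂ, ‖e.symm x‖ ≤ 1 → ∀ m : ℕ, ρ (x ^ m) = ρ x ^ m) ∧
      (∀ x y : ℂ, ‖e.symm x‖ ≤ 1 → ‖e.symm y‖ ≤ 1 → (ρ x = ρ y ↔ ‖e.symm x - e.symm y‖ < 1)) ∧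
      (∀ x : ℂ, ‖e.symm x‖ = 1 → ρ x ≠ 0) ∧
      (∀ w : padicAlgClIntegers p,
        ρ (e (w : PadicAlgCl p)) = residue (padicAlgClIntegers p) w) := by
  classical
  set O := padicAlgClIntegers p with hOdef
  have hmemO : ∀ x : ℂ, ‖e.symm x‖ ≤ 1 → e.symm x ∈ O := fun x hx =>
    (padicAlgCl_mem_valuationSubring_iff p _).mpr hx
  let ι : ∀ x : ℂ, ‖e.symm x‖ ≤ 1 → O := fun x hx => ⟨e.symm x, hmemO x hx⟩
  let ρ : ℂ → padicAlgClResidueField p := fun x =>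
    if hx : ‖e.symm x‖ ≤ 1 then residue O (ι x hx) else 0
  have ρ_of : ∀ (x : ℂ) (hx : ‖e.symm x‖ ≤ 1), ρ x = residue O (ι x hx) := fun x hx => by
    simp only [ρ, dif_pos hx]
  have ρ_mul : ∀ x y : ℂ, ‖e.symm x‖ ≤ 1 → ‖e.symm y‖ ≤ 1 → ρ (x * y) = ρ x * ρ y := by
    intro x y hx hy
    have hxy : ‖e.symm (x * y)‖ ≤ 1 := by
      rw [map_mul, norm_mul]; exact mul_le_one₀ hx (norm_nonneg _) hy
    rw [ρ_of _ hxy, ρ_of _ hx, ρ_of _ hy, ← map_mul]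
    congr 1
    exact Subtype.ext (by simp [ι])
  have ρ_one : ρ 1 = 1 := by
    have h1 : ‖e.symm (1 : ℂ)‖ ≤ 1 := by rw [map_one, norm_one]
    rw [ρ_of _ h1, ← (residue O).map_one]
    congr 1
    exact Subtype.ext (by simp [ι])
  refine ⟨ρ, ρ_mul, ρ_one, fun x hx m => ?_, fun x y hx hy => ?_, fun x hx h0 => ?_, fun w => ?_⟩
  · induction m with
    | zero => rw [pow_zero, pow_zero, ρ_one]
    | succ m ih =>
      rw [pow_succ, pow_succ, ρ_mul _ _ (by rw [map_pow, norm_pow]; exact pow_le_one₀ (norm_nonneg _) hx) hx, ih]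
  · rw [ρ_of _ hx, ρ_of _ hy, residue_eq_residue_iff_norm_sub_lt_one]
  · rw [ρ_of _ hx.le, residue_eq_zero_iff, mem_maximalIdeal_padicAlgClIntegers_iff_norm_lt_one] at h0
    simp [ι, hx] at h0
  · have hw : ‖e.symm (e (w : PadicAlgCl p))‖ ≤ 1 := by
      rw [RingEquiv.symm_apply_apply]; exact (padicAlgCl_mem_valuationSubring_iff p _).mp w.2
    rw [ρ_of _ hw]
    congr 1
    exact Subtype.ext (by simp [ι])

/-! ### Odd representatives modulo an ideal prime to `p` -/

omit [NumberField k] [Fact p.Prime] in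
/-- For `𝔪` prime to the prime ideal `P` and `c` prime to `𝔪` there is `d ∉ P` with `c d ≡ 1 mod 𝔪`.
[folklore] -/
theorem exists_inverse_mod_notMem {P 𝔪 : Ideal (𝓞 k)} (hP : P.IsPrime) (h𝔪P : IsCoprime 𝔪 P)
    (c : 𝓞 k) (hc : IsCoprime (Ideal.span {c}) 𝔪) : ∃ d : 𝓞 k, d ∉ P ∧ c * d - 1 ∈ 𝔪 := by
  obtain ⟨m₁, hm₁, y₁, hy₁, hmy⟩ := Ideal.isCoprime_iff_exists.mp h𝔪P
  obtain ⟨i, hi, j, hj, hij⟩ := Ideal.isCoprime_iff_exists.mp hc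
  obtain ⟨d₀, rfl⟩ := Ideal.mem_span_singleton'.mp hi
  -- `d₀ c + j = 1`; make `d₀` prime to `P` without changing it mod `𝔪`
  refine ⟨d₀ + (1 - d₀) * m₁, fun hmem => ?_, ?_⟩
  · have h1 : d₀ + (1 - d₀) * m₁ - 1 = -((1 - d₀) * y₁) := by
      linear_combination (1 - d₀) * hmy
    have hy : (1 - d₀) * y₁ ∈ P := P.mul_mem_left _ hy₁
    have : (1 : 𝓞 k) ∈ P := by
      have h2 := P.sub_mem hmem (P.neg_mem hy)
      rw [show d₀ + (1 - d₀) * m₁ - -((1 - d₀) * y₁) = 1 by linear_combination h1] at h2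
      exact h2
    exact hP.ne_top ((Ideal.eq_top_iff_one P).mpr this)
  · have : c * (d₀ + (1 - d₀) * m₁) - 1 = -j + c * (1 - d₀) * m₁ := by linear_combination hij
    rw [this]
    exact 𝔪.add_mem (𝔪.neg_mem hj) (𝔪.mul_mem_left _ hm₁)

omit [NumberField k] [Fact p.Prime] in
/-- For `𝔪` prime to `(q)` with `(q)` prime there is `c₀ ≡ q mod 𝔪`, `c₀ ∉ (q)`, `c₀` prime to `𝔪`.
[folklore] -/
theorem exists_rep_generator_notMem {𝔪 : Ideal (𝓞 k)} {q : 𝓞 k} (hP : (Ideal.span {q}).IsPrime)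
    (h𝔪P : IsCoprime 𝔪 (Ideal.span {q})) :
    ∃ c₀ : 𝓞 k, c₀ - q ∈ 𝔪 ∧ c₀ ∉ Ideal.span {q} ∧ IsCoprime (Ideal.span {c₀}) 𝔪 := by
  obtain ⟨m₁, hm₁, y₁, hy₁, hmy⟩ := Ideal.isCoprime_iff_exists.mp h𝔪P
  set P := Ideal.span {q}
  refine ⟨q + (1 - q) * m₁, ?_, fun hmem => ?_, ?_⟩
  · have : q + (1 - q) * m₁ - q = (1 - q) * m₁ := by ring
    rw [this]; exact 𝔪.mul_mem_left _ hm₁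
  · have h1 : q + (1 - q) * m₁ - 1 ∈ P := by
      have : q + (1 - q) * m₁ - 1 = (q - 1) * y₁ := by linear_combination (1 - q) * hmy
      rw [this]; exact P.mul_mem_left _ hy₁
    have : (1 : 𝓞 k) ∈ P := by simpa using P.sub_mem hmem h1
    exact hP.ne_top ((Ideal.eq_top_iff_one P).mpr this)
  · obtain ⟨r, hr⟩ := Ideal.mem_span_singleton'.mp hy₁
    refine Ideal.isCoprime_iff_exists.mpr
      ⟨r * (q + (1 - q) * m₁), Ideal.mem_span_singleton'.mpr ⟨r, rfl⟩, 1 - r * (q + (1 - q) * m₁), ?_, by ring⟩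
    have : 1 - r * (q + (1 - q) * m₁) = m₁ - r * ((1 - q) * m₁) := by linear_combination -hmy - hr
    rw [this]
    exact 𝔪.sub_mem hm₁ (𝔪.mul_mem_left _ (𝔪.mul_mem_left _ hm₁))

end Summit.BirchSwinnertonDyer.BirchSwinnertonDyer.Theorems.HeckeThetaPartner

end
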